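import Literature.NumberTheory.LFunctions.NymanBeurlingRateProofs
import Literature.NumberTheory.LFunctions.MoebiusTwistSoundararajan
import Literature.NumberTheory.LFunctions.SoundararajanTypicalBridge
import Literature.NumberTheory.LFunctions.SoundararajanProp1
import HarnessLib

/-!
# Balazard–de Roton 2010, Théorème 1, from Soundararajan's main proposition (the engine assembled)

Topic `Literature/NumberTheory/LFunctions`; assembly file for the named fact
`Literature.NumberTheory.LFunctions.BalazardDeRoton2010_thm1` (`NymanBeurlingRate.lean`): under RH,
`d_N² ≪_δ (log log N)^{5/2+δ}(log N)^{-1/2}` (M. Balazard, A. de Roton, Int. J. Number Theory 6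
(2010) 883–903 = arXiv:0812.1689, Théorème 1).

`NymanBeurlingRateProofs.lean` reduces Théorème 1 to the two deep inputs (A) `M(x) ≪ √x
exp((log x)^{1/2}(log log x)^{5/2+δ})` and (B) Prop. 12 of the 2010 paper
(`BalazardDeRoton2010_thm1_of_deep`); `MertensBoundSoundararajan.lean` and
`MoebiusTwistSoundararajan.lean` prove (A) and (B) from the conclusions of M. Balazard, A. de Roton,
*Notes de lecture de l'article "Partial sums of the Möbius function" de K. Soundararajan*,
arXiv:0810.3587, Props. 1, 18, 20 (`Prop1With`, `Prop18With`, `Prop20With`), needed only at the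
levels `0 < δ ≤ 1/12`. Props. 1, 18 and 20 are theorems of the tree under RH
(`SoundTest.prop1With_of_RH`, `SoundararajanProp1.lean`; `prop18With_of_RH`, `prop20With_of_RH`,
`SoundararajanTypicalBridge.lean`). Hence:

* `SoundContour.mertens_bound_of_engine'` — (A) from (P1), (P18), (P20) at levels `δ ≤ 1/12`
  (the wrapper of `SoundContour.exists_mertens_nat_le`, as `mertens_bound_of_engine` but with the
  hypotheses restricted to the levels actually used);
* `BalazardDeRoton2010_thm1_of_engine` — Théorème 1 from (P1), (P18), (P20) at levels `δ ≤ 1/12`;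
* `BalazardDeRoton2010_thm1_of_prop1` — Théorème 1 from (P1) alone, i.e. from
  arXiv:0810.3587 Prop. 1 under RH (Soundararajan's main proposition: the lower bound for
  `log|ζ(σ+it)|` near `V`-typical ordinates), in the packaged form
  `RH → ∀ δ ∈ (0, 1/12], ∃ D T₀, TypicalPointwise.Prop1With δ D T₀`;
* `BalazardDeRoton2010_thm1_holds` — **the discharge of the named fact**, feeding
  `SoundTest.prop1With_of_RH` into the previous theorem.

## References

* [BalazardDeRoton2010] M. Balazard, A. de Roton, Int. J. Number Theory 6 (2010) 883–903, Théorème 1.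
* [BalazardRoton2008] M. Balazard, A. de Roton, arXiv:0810.3587, Props. 1, 18, 20 and Théorème 1.
* K. Soundararajan, Partial sums of the Möbius function, J. reine angew. Math. 631 (2009) 141–152.
-/

noncomputable section

open Complex

namespace Literature.NumberTheory.LFunctions

open Soundararajan SoundContour TypicalPointwise TypicalLadder TypicalCounting BalazardDeRoton

/-- **Soundararajan's theorem (Balazard–de Roton's form) from the engine at levels `δ ≤ 1/12`.**
Under RH and the conclusions of Balazard–de Roton 2008, Props. 1, 18, 20 for `0 < δ ≤ 1/12`:
for every `δ' ∈ (0, ½]` there is `C > 0` with `|M(x)| ≤ C √x exp((log x)^{1/2}(log log x)^{5/2+δ'})`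
for all `x ≥ 3` (hypothesis `hA` of `BalazardDeRoton2010_thm1_of_deep`; same proof as
`SoundContour.mertens_bound_of_engine`, which asks for all levels `δ ≤ 1`).
[cite: BalazardRoton2008, Théorème 1] -/
theorem SoundContour.mertens_bound_of_engine' (hRH : RiemannHypothesis)
    (h1 : ∀ δ : ℝ, 0 < δ → δ ≤ 1 / 12 → ∃ D T₀ : ℝ, Prop1With δ D T₀)
    (h18 : ∀ δ : ℝ, 0 < δ → δ ≤ 1 / 12 → ∃ T₀ : ℝ, Prop18With δ T₀)
    (h20 : ∀ δ : ℝ, 0 < δ → δ ≤ 1 / 12 → ∃ C D T₀ : ℝ, Prop20With δ C D T₀) :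
    ∀ δ : ℝ, 0 < δ → δ ≤ 1 / 2 → ∃ C : ℝ, 0 < C ∧ ∀ x : ℝ, 3 ≤ x →
      |(mertensFunction x : ℝ)| ≤ C * Real.sqrt x * gFun (5 / 2 + δ) x := by
  intro δ' hδ'0 hδ'1
  set δ := δ' / 6 with hδ
  have hδ0 : 0 < δ := by positivity
  have hδ1 : δ ≤ 1 / 12 := by rw [hδ]; linarith
  obtain ⟨N₁, K, hK, hMN⟩ := exists_mertens_nat_le hRH hδ0 (by linarith) (h1 δ hδ0 hδ1) (h18 δ hδ0 hδ1)
    (h20 δ hδ0 hδ1)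
  have hp : (5 / 2 + 6 * δ : ℝ) = 5 / 2 + δ' := by rw [hδ]; ring
  refine ⟨max K (max N₁ 16), lt_max_of_lt_left hK, fun x hx ↦ ?_⟩
  set N := ⌊x⌋₊ with hN
  have hx0 : 0 < x := by linarith
  have hNx : (N : ℝ) ≤ x := Nat.floor_le hx0.le
  have hMx : mertensFunction x = mertensFunction (N : ℝ) := by
    simp [mertensFunction, hN]
  have hG1 : 1 ≤ gFun (5 / 2 + δ') x := by
    unfold gFun eExp
    apply Real.one_le_exp
    have hlx : 1 ≤ Real.log x := by
      rw [← Real.log_exp 1]; refine Real.log_le_log (Real.exp_pos 1) ?_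
      have := Real.exp_one_lt_d9; linarith
    exact mul_nonneg (Real.rpow_nonneg (by linarith) _) (Real.rpow_nonneg (Real.log_nonneg hlx) _)
  have hsx1 : 1 ≤ Real.sqrt x := by rw [← Real.sqrt_one]; exact Real.sqrt_le_sqrt (by linarith)
  rw [hMx]
  rcases le_or_gt (max N₁ 16) N with hbig | hsmall
  · have hN₁ : N₁ ≤ N := le_trans (le_max_left _ _) hbig
    have hN16 : 16 ≤ N := le_trans (le_max_right _ _) hbig
    have hN16' : (16 : ℝ) ≤ N := by exact_mod_cast hN16
    have h := hMN N hN₁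
    have hlam : Real.exp (lam (5 / 2 + 6 * δ) N) = gFun (5 / 2 + δ') N := by
      rw [hp]; rfl
    rw [hlam] at h
    calc |(mertensFunction (N : ℝ) : ℝ)| ≤ K * Real.sqrt N * gFun (5 / 2 + δ') N := h
      _ ≤ K * Real.sqrt x * gFun (5 / 2 + δ') x := by
          refine mul_le_mul (mul_le_mul_of_nonneg_left (Real.sqrt_le_sqrt hNx) hK.le)
            (gFun_mono (by linarith) hN16' hNx) (gFun_pos _ _).le (by positivity)
      _ ≤ max K (max N₁ 16) * Real.sqrt x * gFun (5 / 2 + δ') x :=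
          mul_le_mul_of_nonneg_right (mul_le_mul_of_nonneg_right (le_max_left _ _)
            (Real.sqrt_nonneg _)) (gFun_pos _ _).le
  · have h1' : |(mertensFunction (N : ℝ) : ℝ)| ≤ N := MertensDictionary.abs_mertensFunction_natCast_le N
    have h2 : (N : ℝ) ≤ max K (max (N₁ : ℝ) 16) := by
      have : (N : ℝ) ≤ ((max N₁ 16 : ℕ) : ℝ) := by exact_mod_cast hsmall.le
      push_cast at this
      exact this.trans (le_max_right _ _)
    have h3 : (max K (max N₁ 16) : ℝ) ≤ max K (max N₁ 16) * Real.sqrt x * gFun (5 / 2 + δ') x := by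
      have h0 : 0 ≤ max K (max (N₁ : ℝ) 16) := le_trans hK.le (le_max_left _ _)
      calc (max K (max N₁ 16) : ℝ) = max K (max N₁ 16) * 1 * 1 := by ring
        _ ≤ max K (max N₁ 16) * Real.sqrt x * gFun (5 / 2 + δ') x :=
            mul_le_mul (mul_le_mul_of_nonneg_left hsx1 h0) hG1 zero_le_one (by positivity)
    linarith

/-- **Balazard–de Roton 2010, Théorème 1, from the engine (P1), (P18), (P20) of Soundararajan's
method** (Balazard–de Roton 2008, Props. 1, 18, 20, at the levels `0 < δ ≤ 1/12`).
[cite: BalazardDeRoton2010, Théorème 1] -/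
theorem BalazardDeRoton2010_thm1_of_engine
    (h1 : RiemannHypothesis → ∀ δ : ℝ, 0 < δ → δ ≤ 1 / 12 → ∃ D T₀ : ℝ, Prop1With δ D T₀)
    (h18 : RiemannHypothesis → ∀ δ : ℝ, 0 < δ → δ ≤ 1 / 12 → ∃ T₀ : ℝ, Prop18With δ T₀)
    (h20 : RiemannHypothesis → ∀ δ : ℝ, 0 < δ → δ ≤ 1 / 12 → ∃ C D T₀ : ℝ, Prop20With δ C D T₀) :
    BalazardDeRoton2010_thm1 :=
  BalazardDeRoton2010_thm1_of_deep
    (fun hRH ↦ mertens_bound_of_engine' hRH (h1 hRH) (h18 hRH) (h20 hRH))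
    (fun hRH ↦ moebiusSum_twist_bound_of_engine hRH (h1 hRH) (h18 hRH) (h20 hRH))

/-- **Balazard–de Roton 2010, Théorème 1, from Proposition 1 of Balazard–de Roton 2008 alone.**
Props. 18 and 20 are theorems of the tree under RH (`prop18With_of_RH`, `prop20With_of_RH`); the
remaining hypothesis is Soundararajan's main proposition (arXiv:0810.3587, Prop. 1, under RH) in
the packaged form `TypicalPointwise.Prop1With`: for `T ≥ T₀`, `(log log T)² ≤ V ≤ log T/log log T`
and `t` a `V`-typical ordinate of size `T`,
`log|ζ(σ+it)| ≥ −V log((V/log T)/(σ−½)) − 2(1+δ)V log log V − DVδ⁻²` (`½ < σ ≤ ½ + V/log T`) and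
`log|ζ(σ+it)| ≥ −DVδ⁻¹` (`½ + V/log T ≤ σ ≤ 2`).
[cite: BalazardDeRoton2010, Théorème 1; BalazardRoton2008, Prop. 1] -/
theorem BalazardDeRoton2010_thm1_of_prop1
    (h1 : RiemannHypothesis → ∀ δ : ℝ, 0 < δ → δ ≤ 1 / 12 → ∃ D T₀ : ℝ, Prop1With δ D T₀) :
    BalazardDeRoton2010_thm1 :=
  BalazardDeRoton2010_thm1_of_engine h1
    (fun hRH δ hδ0 hδ1 ↦ prop18With_of_RH hRH hδ0 (by linarith))
    (fun hRH δ hδ0 hδ1 ↦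
      let ⟨T₀, h⟩ := prop20With_of_RH hRH hδ0 (by linarith : δ ≤ 1)
      ⟨1, 12, T₀, h⟩)

/-- **Balazard–de Roton 2010, Théorème 1** (M. Balazard, A. de Roton, Int. J. Number Theory 6
(2010) 883–903, Thm. 1: under RH, `d_N² ≪_δ (log log N)^{5/2+δ}(log N)^{−1/2}`): the named fact
`BalazardDeRoton2010_thm1` holds — by the published proof (Props. 1–14 of the 2010 paper,
`NymanBeurlingRateProofs.lean` and its imports) with both deep inputs supplied by Soundararajan's
method (Balazard–de Roton 2008, Props. 1, 18, 20, theorems of the tree under RH).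
[cite: BalazardDeRoton2010, Théorème 1] -/
theorem BalazardDeRoton2010_thm1_holds : BalazardDeRoton2010_thm1 :=
  BalazardDeRoton2010_thm1_of_prop1 fun hRH _δ hδ0 hδ1 ↦
    let ⟨D, T₀, _, h⟩ := SoundTest.prop1With_of_RH hRH hδ0 (by linarith)
    ⟨D, T₀, h⟩

end Literature.NumberTheory.LFunctions

end
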